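import Mathlib
import Summits.KontsevichZagierPeriods.KontsevichZagierPeriods.Theorems.SoloInformedLogRoomUnbounded
import Summits.KontsevichZagierPeriods.KontsevichZagierPeriods.Theorems.SoloInformedFibreInterval
import HarnessLib

/-!
# SoloInformed — log-room on a normalised fibre with extended upper endpoint, several centres

Solo programme `solo-KontsevichZagierPeriods-informed`, attempt (A390-ii), file F2b of the
KERNEL LEMMA I programme (integrability loci of `ℚ`-semialgebraic families are
`ℚ`-semialgebraic, via the vendored Lion–Rolin preparation fact
`Literature.ModelTheory.ExponentialFields.semialgebraicPreparation`).

* `soloInformedEndData α₀ b` — the endpoint data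
  `log⁺ α₀ + log⁺ α₀⁻¹ + log⁺ b + log⁺ b⁻¹ + log⁺ (b - α₀)⁻¹` of a normalised fibre;
* `soloInformed_logRoom_EIoo` — the log-room inequality of files 530/531
  (`soloInformed_logRoom_Ioo`, `soloInformed_logRoom_Ioi`) as ONE statement over a normalised
  fibre `soloInformedEIoo α₀ β`, `0 ≤ α₀ < β ≤ ⊤`, with one excluded centre;
* `soloInformed_logRoom_EIoo_sum` — finitely many excluded centres `dᵢ` with weights
  `0 ≤ R'ᵢ ≤ R`: `∫ u^r (K + Σᵢ R'ᵢ |log|u-dᵢ||)^p ≤ C R^p (1 + K + Σᵢ log⁺|dᵢ| + E)^p ∫ u^r`,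
  `C = C(r,p,N)` — the form consumed by the fibre step of the log-room theorem T'(m)
  (a prepared family contributes one centre per prepared function).

References: Lion–Rolin, Ann. Inst. Fourier 48 (1998) 755–767, §1 (`LionRolin1998`);
Comte–Lion–Rolin, Illinois J. Math. 44 (2000) 884–888, Thm 1′ (`doi:10.1215/ijm/1255984698`).
-/

noncomputable section

open MeasureTheory Set Real
open scoped ENNReal

namespace Summit.KontsevichZagierPeriods.KontsevichZagierPeriods.Theorems

/-! ### Log-room on a normalised fibre with extended upper endpoint -/

/-- Endpoint data `E(α₀, b) = log⁺ α₀ + log⁺ α₀⁻¹ + log⁺ b + log⁺ b⁻¹ + log⁺ (b - α₀)⁻¹` of a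
normalised fibre `(α₀, β)`, `b` a real stand-in for `β` (junk, and harmless, when `β = ⊤`).
[cite: LionRolin1998, §1] -/
def soloInformedEndData (α₀ b : ℝ) : ℝ :=
  log⁺ α₀ + log⁺ α₀⁻¹ + log⁺ b + log⁺ b⁻¹ + log⁺ (b - α₀)⁻¹

/-- Endpoint data is nonnegative. [cite: LionRolin1998, §1] -/
theorem soloInformed_endData_nonneg (α₀ b : ℝ) : 0 ≤ soloInformedEndData α₀ b :=
  add_nonneg (add_nonneg (add_nonneg (add_nonneg Real.posLog_nonneg Real.posLog_nonneg)
    Real.posLog_nonneg) Real.posLog_nonneg) Real.posLog_nonneg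

/-- LOG-ROOM ON A NORMALISED FIBRE (files 530/531 in one statement): for `0 ≤ α₀ < β ≤ ⊤` and a
centre `d` off the fibre, `∫ u^r (K + |log|u-d||)^p ≤ C (1 + K + log⁺|d| + E(α₀,b))^p ∫ u^r`,
`C = C(r,p)`. [cite: LionRolin1998, §1] -/
theorem soloInformed_logRoom_EIoo (r : ℝ) (p : ℕ) : ∃ C : ℝ, 1 ≤ C ∧
    ∀ (α₀ : ℝ) (β : EReal) (b d K : ℝ), 0 ≤ α₀ → (α₀ : EReal) < β → (β = ⊤ ∨ β = (b : EReal)) →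
      ((d : EReal) ≤ α₀ ∨ β ≤ (d : EReal)) → 0 ≤ K →
      ∫⁻ u in soloInformedEIoo α₀ β, ENNReal.ofReal (u ^ r * (K + |Real.log (|u - d|)|) ^ p) ≤
        ENNReal.ofReal (C * (1 + K + log⁺ |d| + soloInformedEndData α₀ b) ^ p) *
          ∫⁻ u in soloInformedEIoo α₀ β, ENNReal.ofReal (u ^ r) := by
  obtain ⟨C₁, hC₁, H₁⟩ := soloInformed_logRoom_Ioo r p
  obtain ⟨C₂, hC₂, H₂⟩ := soloInformed_logRoom_Ioi r p
  refine ⟨max C₁ C₂, le_max_of_le_left hC₁, ?_⟩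
  intro α₀ β b d K hα hαβ hβ hd hK
  have hC0 : 0 ≤ max C₁ C₂ := le_trans zero_le_one (le_max_of_le_left hC₁)
  have hd0 : (0 : ℝ) ≤ log⁺ |d| := Real.posLog_nonneg
  have e1 : (0 : ℝ) ≤ log⁺ α₀ := Real.posLog_nonneg
  have e2 : (0 : ℝ) ≤ log⁺ α₀⁻¹ := Real.posLog_nonneg
  have e3 : (0 : ℝ) ≤ log⁺ b := Real.posLog_nonneg
  have e4 : (0 : ℝ) ≤ log⁺ b⁻¹ := Real.posLog_nonneg
  have e5 : (0 : ℝ) ≤ log⁺ (b - α₀)⁻¹ := Real.posLog_nonneg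
  rcases hβ with rfl | rfl
  · rw [soloInformed_EIoo_coe_top]
    have hd' : d ≤ α₀ := by
      rcases hd with hd | hd
      · exact_mod_cast hd
      · exact absurd hd (by simp)
    refine (H₂ α₀ d K hα hd' hK).trans ?_
    refine mul_le_mul_of_nonneg_right (ENNReal.ofReal_le_ofReal ?_) zero_le
    have hsum : 1 + K + log⁺ |d| + log⁺ α₀ + log⁺ α₀⁻¹ ≤
        1 + K + log⁺ |d| + soloInformedEndData α₀ b := by
      unfold soloInformedEndData; linarith
    have hsum0 : 0 ≤ 1 + K + log⁺ |d| + log⁺ α₀ + log⁺ α₀⁻¹ := by linarith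
    exact mul_le_mul (le_max_right _ _) (pow_le_pow_left₀ hsum0 hsum p) (pow_nonneg hsum0 p) hC0
  · rw [soloInformed_EIoo_coe_coe]
    have hαb : α₀ < b := by exact_mod_cast hαβ
    have hd' : d ≤ α₀ ∨ b ≤ d := by
      rcases hd with hd | hd
      · exact Or.inl (by exact_mod_cast hd)
      · exact Or.inr (by exact_mod_cast hd)
    refine (H₁ α₀ b d K hα hαb hd' hK).trans ?_
    refine mul_le_mul_of_nonneg_right (ENNReal.ofReal_le_ofReal ?_) zero_le
    have hsum : 1 + K + log⁺ |d| + log⁺ b + log⁺ b⁻¹ + log⁺ α₀⁻¹ + log⁺ (b - α₀)⁻¹ ≤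
        1 + K + log⁺ |d| + soloInformedEndData α₀ b := by
      unfold soloInformedEndData; linarith
    have hsum0 : 0 ≤ 1 + K + log⁺ |d| + log⁺ b + log⁺ b⁻¹ + log⁺ α₀⁻¹ + log⁺ (b - α₀)⁻¹ := by
      linarith
    exact mul_le_mul (le_max_left _ _) (pow_le_pow_left₀ hsum0 hsum p) (pow_nonneg hsum0 p) hC0

/-! ### Several centres -/

/-- Measurability of the single-centre weight `u ↦ ofReal (A (u^r |log|u-d||^p))`.
[cite: LionRolin1998, §1] -/
theorem soloInformed_measurable_weight_absLog (A r d : ℝ) (p : ℕ) :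
    Measurable fun u : ℝ => ENNReal.ofReal (A * (u ^ r * |Real.log (|u - d|)| ^ p)) :=
  (measurable_const.mul ((measurable_id.pow_const r).mul
    ((continuous_abs.measurable.comp (Real.measurable_log.comp
      (continuous_abs.measurable.comp (measurable_id.sub_const d)))).pow_const p))).ennreal_ofReal

/-- Jensen step: `(K + Σᵢ xᵢ)^(q+1) ≤ (N+1)^q (K^(q+1) + Σᵢ xᵢ^(q+1))` for `K, xᵢ ≥ 0`.
[cite: LionRolin1998, §1] -/
theorem soloInformed_add_sum_pow_le {N : ℕ} (q : ℕ) {K : ℝ} {x : Fin N → ℝ} (hK : 0 ≤ K)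
    (hx : ∀ i, 0 ≤ x i) :
    (K + ∑ i, x i) ^ (q + 1) ≤ ((N : ℝ) + 1) ^ q * (K ^ (q + 1) + ∑ i, x i ^ (q + 1)) := by
  have hy : ∀ j ∈ (Finset.univ : Finset (Fin (N + 1))), 0 ≤ (Fin.cons K x : Fin (N + 1) → ℝ) j := by
    intro j _
    refine Fin.cases ?_ (fun i => ?_) j
    · simpa using hK
    · simpa using hx i
  have h := pow_sum_le_card_mul_sum_pow hy q
  simp only [Fin.sum_univ_succ, Fin.cons_zero, Fin.cons_succ, Finset.card_univ,
    Fintype.card_fin, Nat.cast_add, Nat.cast_one] at h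
  exact h

/-- Weights step: `K + Σᵢ R'ᵢ xᵢ ≤ R (K + Σᵢ xᵢ)` for `0 ≤ R'ᵢ ≤ R`, `1 ≤ R`, `K, xᵢ ≥ 0`.
[cite: LionRolin1998, §1] -/
theorem soloInformed_add_sum_mul_le {N : ℕ} {K R : ℝ} {x R' : Fin N → ℝ} (hK : 0 ≤ K) (hR : 1 ≤ R)
    (hR' : ∀ i, 0 ≤ R' i ∧ R' i ≤ R) (hx : ∀ i, 0 ≤ x i) :
    K + ∑ i, R' i * x i ≤ R * (K + ∑ i, x i) := by
  have h1 : ∑ i, R' i * x i ≤ ∑ i, R * x i :=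
    Finset.sum_le_sum fun i _ => mul_le_mul_of_nonneg_right (hR' i).2 (hx i)
  rw [← Finset.mul_sum] at h1
  nlinarith [Finset.sum_nonneg (fun i (_ : i ∈ (Finset.univ : Finset (Fin N))) => hx i)]

/-- LOG-ROOM WITH SEVERAL CENTRES on a normalised fibre: for `0 ≤ α₀ < β ≤ ⊤`, centres `dᵢ` off
the fibre and weights `0 ≤ R'ᵢ ≤ R`,
`∫ u^r (K + Σᵢ R'ᵢ |log|u-dᵢ||)^p ≤ C R^p (1 + K + Σᵢ log⁺|dᵢ| + E(α₀,b))^p ∫ u^r`, `C = C(r,p,N)`.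
[cite: LionRolin1998, §1] -/
theorem soloInformed_logRoom_EIoo_sum (r : ℝ) (p N : ℕ) : ∃ C : ℝ, 1 ≤ C ∧
    ∀ (α₀ : ℝ) (β : EReal) (b K R : ℝ) (d R' : Fin N → ℝ), 0 ≤ α₀ → (α₀ : EReal) < β →
      (β = ⊤ ∨ β = (b : EReal)) → (∀ i, (d i : EReal) ≤ α₀ ∨ β ≤ (d i : EReal)) → 0 ≤ K →
      1 ≤ R → (∀ i, 0 ≤ R' i ∧ R' i ≤ R) →
      ∫⁻ u in soloInformedEIoo α₀ β,
          ENNReal.ofReal (u ^ r * (K + ∑ i, R' i * |Real.log (|u - d i|)|) ^ p) ≤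
        ENNReal.ofReal (C * R ^ p *
            (1 + K + ∑ i, log⁺ |d i| + soloInformedEndData α₀ b) ^ p) *
          ∫⁻ u in soloInformedEIoo α₀ β, ENNReal.ofReal (u ^ r) := by
  obtain ⟨C₀, hC₀, H₀⟩ := soloInformed_logRoom_EIoo r p
  have hN1 : (1 : ℝ) ≤ (N : ℝ) + 1 := by
    have : (0 : ℝ) ≤ N := Nat.cast_nonneg N
    linarith
  refine ⟨C₀ * ((N : ℝ) + 1) ^ (2 * p), ?_, ?_⟩
  · exact le_trans hC₀ (le_mul_of_one_le_right (le_trans zero_le_one hC₀) (one_le_pow₀ hN1))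
  intro α₀ β b K R d R' hα hαβ hβ hd hK hR hR'
  set J := soloInformedEIoo (α₀ : EReal) β with hJ
  set E := soloInformedEndData α₀ b with hE
  set M := 1 + K + ∑ i, log⁺ |d i| + E with hM
  set I := ∫⁻ u in J, ENNReal.ofReal (u ^ r) with hI
  have hJm : MeasurableSet J := soloInformed_measurableSet_EIoo _ _
  have hE0 : 0 ≤ E := soloInformed_endData_nonneg α₀ b
  have hR0 : 0 ≤ R := le_trans zero_le_one hR
  have hlog0 : ∀ i, (0 : ℝ) ≤ log⁺ |d i| := fun i => Real.posLog_nonneg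
  have hsum0 : 0 ≤ ∑ i, log⁺ |d i| := Finset.sum_nonneg fun i _ => hlog0 i
  have hM1 : 1 ≤ M := by rw [hM]; linarith
  have hM0 : 0 ≤ M := le_trans zero_le_one hM1
  have hKM : K ≤ M := by rw [hM]; linarith
  have hΛM : ∀ i, 1 + log⁺ |d i| + E ≤ M := by
    intro i
    have : log⁺ |d i| ≤ ∑ j, log⁺ |d j| :=
      Finset.single_le_sum (fun j _ => hlog0 j) (Finset.mem_univ i)
    rw [hM]; linarith
  have hC00 : 0 ≤ C₀ := le_trans zero_le_one hC₀
  -- the case `p = 0` is trivial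
  rcases Nat.eq_zero_or_pos p with hp | hp
  · subst hp
    have hlhs : ∫⁻ u in J, ENNReal.ofReal (u ^ r * (K + ∑ i, R' i * |Real.log (|u - d i|)|) ^ 0) = I := by
      simp only [pow_zero, mul_one, hI]
    have h1 : (1 : ℝ) ≤ C₀ * ((N : ℝ) + 1) ^ (2 * 0) * R ^ 0 * M ^ 0 := by
      simp only [mul_zero, pow_zero, mul_one]; exact hC₀
    rw [hlhs]
    calc I = 1 * I := (one_mul I).symm
      _ ≤ _ := mul_le_mul_of_nonneg_right
          (by rw [← ENNReal.ofReal_one]; exact ENNReal.ofReal_le_ofReal h1) zero_le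
  obtain ⟨q, rfl⟩ : ∃ q, p = q + 1 := ⟨p - 1, by omega⟩
  -- pointwise bound on the fibre
  set c₁ : ℝ := R ^ (q + 1) * ((N : ℝ) + 1) ^ q with hc₁
  have hc₁0 : 0 ≤ c₁ := mul_nonneg (pow_nonneg hR0 _) (pow_nonneg (le_trans zero_le_one hN1) _)
  have hpt : ∀ u ∈ J, ENNReal.ofReal (u ^ r * (K + ∑ i, R' i * |Real.log (|u - d i|)|) ^ (q + 1)) ≤
      ENNReal.ofReal (c₁ * K ^ (q + 1) * u ^ r) +
        ∑ i, ENNReal.ofReal (c₁ * (u ^ r * |Real.log (|u - d i|)| ^ (q + 1))) := by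
    intro u hu
    have hu0 : 0 ≤ u := by
      have h1 := hu.1
      rw [EReal.coe_lt_coe_iff] at h1
      linarith
    have hur : 0 ≤ u ^ r := Real.rpow_nonneg hu0 r
    have hx : ∀ i, 0 ≤ |Real.log (|u - d i|)| := fun i => abs_nonneg _
    have h1 : K + ∑ i, R' i * |Real.log (|u - d i|)| ≤ R * (K + ∑ i, |Real.log (|u - d i|)|) :=
      soloInformed_add_sum_mul_le hK hR hR' hx
    have h1' : 0 ≤ K + ∑ i, R' i * |Real.log (|u - d i|)| :=
      add_nonneg hK (Finset.sum_nonneg fun i _ => mul_nonneg (hR' i).1 (hx i))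
    have h2 : (K + ∑ i, |Real.log (|u - d i|)|) ^ (q + 1) ≤
        ((N : ℝ) + 1) ^ q * (K ^ (q + 1) + ∑ i, |Real.log (|u - d i|)| ^ (q + 1)) :=
      soloInformed_add_sum_pow_le q hK hx
    have h3 : (K + ∑ i, R' i * |Real.log (|u - d i|)|) ^ (q + 1) ≤
        c₁ * (K ^ (q + 1) + ∑ i, |Real.log (|u - d i|)| ^ (q + 1)) := by
      calc (K + ∑ i, R' i * |Real.log (|u - d i|)|) ^ (q + 1)
          ≤ (R * (K + ∑ i, |Real.log (|u - d i|)|)) ^ (q + 1) := pow_le_pow_left₀ h1' h1 _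
        _ = R ^ (q + 1) * (K + ∑ i, |Real.log (|u - d i|)|) ^ (q + 1) := by rw [mul_pow]
        _ ≤ R ^ (q + 1) * (((N : ℝ) + 1) ^ q *
              (K ^ (q + 1) + ∑ i, |Real.log (|u - d i|)| ^ (q + 1))) :=
            mul_le_mul_of_nonneg_left h2 (pow_nonneg hR0 _)
        _ = c₁ * (K ^ (q + 1) + ∑ i, |Real.log (|u - d i|)| ^ (q + 1)) := by rw [hc₁]; ring
    have hterm0 : ∀ i, 0 ≤ c₁ * (u ^ r * |Real.log (|u - d i|)| ^ (q + 1)) :=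
      fun i => mul_nonneg hc₁0 (mul_nonneg hur (pow_nonneg (hx i) _))
    calc ENNReal.ofReal (u ^ r * (K + ∑ i, R' i * |Real.log (|u - d i|)|) ^ (q + 1))
        ≤ ENNReal.ofReal (u ^ r * (c₁ * (K ^ (q + 1) + ∑ i, |Real.log (|u - d i|)| ^ (q + 1)))) :=
          ENNReal.ofReal_le_ofReal (mul_le_mul_of_nonneg_left h3 hur)
      _ = ENNReal.ofReal (c₁ * K ^ (q + 1) * u ^ r +
            ∑ i, c₁ * (u ^ r * |Real.log (|u - d i|)| ^ (q + 1))) := by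
          congr 1
          rw [mul_add, mul_add, Finset.mul_sum, Finset.mul_sum]
          congr 1
          · ring
          · exact Finset.sum_congr rfl fun i _ => by ring
      _ = ENNReal.ofReal (c₁ * K ^ (q + 1) * u ^ r) +
            ENNReal.ofReal (∑ i, c₁ * (u ^ r * |Real.log (|u - d i|)| ^ (q + 1))) :=
          ENNReal.ofReal_add (mul_nonneg (mul_nonneg hc₁0 (pow_nonneg hK _)) hur)
            (Finset.sum_nonneg fun i _ => hterm0 i)
      _ = _ := by rw [ENNReal.ofReal_sum_of_nonneg fun i _ => hterm0 i]
  -- integrate the pointwise bound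
  have hmeasK : Measurable fun u : ℝ => ENNReal.ofReal (c₁ * K ^ (q + 1) * u ^ r) :=
    soloInformed_measurable_ofReal_const_mul_rpow _ _
  have hstep1 : ∫⁻ u in J, ENNReal.ofReal (u ^ r * (K + ∑ i, R' i * |Real.log (|u - d i|)|) ^ (q + 1))
      ≤ ENNReal.ofReal (c₁ * K ^ (q + 1)) * I +
        ∑ i, ENNReal.ofReal c₁ * ∫⁻ u in J, ENNReal.ofReal (u ^ r * |Real.log (|u - d i|)| ^ (q + 1)) := by
    calc ∫⁻ u in J, ENNReal.ofReal (u ^ r * (K + ∑ i, R' i * |Real.log (|u - d i|)|) ^ (q + 1))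
        ≤ ∫⁻ u in J, (ENNReal.ofReal (c₁ * K ^ (q + 1) * u ^ r) +
            ∑ i, ENNReal.ofReal (c₁ * (u ^ r * |Real.log (|u - d i|)| ^ (q + 1)))) :=
          setLIntegral_mono' hJm hpt
      _ = (∫⁻ u in J, ENNReal.ofReal (c₁ * K ^ (q + 1) * u ^ r)) +
            ∫⁻ u in J, ∑ i, ENNReal.ofReal (c₁ * (u ^ r * |Real.log (|u - d i|)| ^ (q + 1))) :=
          lintegral_add_left hmeasK _
      _ = ENNReal.ofReal (c₁ * K ^ (q + 1)) * I +
            ∑ i, ∫⁻ u in J, ENNReal.ofReal (c₁ * (u ^ r * |Real.log (|u - d i|)| ^ (q + 1))) := by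
          rw [lintegral_finsetSum _ (fun i _ => soloInformed_measurable_weight_absLog c₁ r (d i) (q + 1)),
            soloInformed_setLIntegral_ofReal_const_mul (mul_nonneg hc₁0 (pow_nonneg hK _))]
      _ = _ := by
          congr 1
          exact Finset.sum_congr rfl fun i _ => soloInformed_setLIntegral_ofReal_const_mul hc₁0 _ _
  -- single-centre log-room for each centre
  have hstep2 : ∀ i, ∫⁻ u in J, ENNReal.ofReal (u ^ r * |Real.log (|u - d i|)| ^ (q + 1)) ≤
      ENNReal.ofReal (C₀ * M ^ (q + 1)) * I := by
    intro i
    have h := H₀ α₀ β b (d i) 0 hα hαβ hβ (hd i) le_rfl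
    simp only [zero_add, add_zero] at h
    refine h.trans (mul_le_mul_of_nonneg_right (ENNReal.ofReal_le_ofReal ?_) zero_le)
    refine mul_le_mul_of_nonneg_left (pow_le_pow_left₀ ?_ ?_ _) hC00
    · linarith [hlog0 i]
    · have := hΛM i; linarith
  -- assemble the constants
  have hKq : c₁ * K ^ (q + 1) ≤ c₁ * C₀ * M ^ (q + 1) := by
    calc c₁ * K ^ (q + 1) ≤ c₁ * M ^ (q + 1) :=
          mul_le_mul_of_nonneg_left (pow_le_pow_left₀ hK hKM _) hc₁0
      _ = c₁ * 1 * M ^ (q + 1) := by ring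
      _ ≤ c₁ * C₀ * M ^ (q + 1) :=
          mul_le_mul_of_nonneg_right (mul_le_mul_of_nonneg_left hC₀ hc₁0) (pow_nonneg hM0 _)
  have htot : c₁ * C₀ * M ^ (q + 1) + ∑ _i : Fin N, c₁ * (C₀ * M ^ (q + 1)) ≤
      C₀ * ((N : ℝ) + 1) ^ (2 * (q + 1)) * R ^ (q + 1) * M ^ (q + 1) := by
    rw [Finset.sum_const, Finset.card_univ, Fintype.card_fin, nsmul_eq_mul]
    have hcomb : c₁ * C₀ * M ^ (q + 1) + (N : ℝ) * (c₁ * (C₀ * M ^ (q + 1))) =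
        C₀ * (((N : ℝ) + 1) ^ (q + 1) * R ^ (q + 1)) * M ^ (q + 1) := by
      rw [hc₁]; ring
    rw [hcomb]
    have hpow : ((N : ℝ) + 1) ^ (q + 1) ≤ ((N : ℝ) + 1) ^ (2 * (q + 1)) :=
      pow_le_pow_right₀ hN1 (by omega)
    have : C₀ * (((N : ℝ) + 1) ^ (q + 1) * R ^ (q + 1)) ≤ C₀ * (((N : ℝ) + 1) ^ (2 * (q + 1)) * R ^ (q + 1)) :=
      mul_le_mul_of_nonneg_left (mul_le_mul_of_nonneg_right hpow (pow_nonneg hR0 _)) hC00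
    calc C₀ * (((N : ℝ) + 1) ^ (q + 1) * R ^ (q + 1)) * M ^ (q + 1)
        ≤ C₀ * (((N : ℝ) + 1) ^ (2 * (q + 1)) * R ^ (q + 1)) * M ^ (q + 1) :=
          mul_le_mul_of_nonneg_right this (pow_nonneg hM0 _)
      _ = _ := by ring
  calc ∫⁻ u in J, ENNReal.ofReal (u ^ r * (K + ∑ i, R' i * |Real.log (|u - d i|)|) ^ (q + 1))
      ≤ ENNReal.ofReal (c₁ * K ^ (q + 1)) * I +
        ∑ i, ENNReal.ofReal c₁ * ∫⁻ u in J, ENNReal.ofReal (u ^ r * |Real.log (|u - d i|)| ^ (q + 1)) :=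
        hstep1
    _ ≤ ENNReal.ofReal (c₁ * C₀ * M ^ (q + 1)) * I +
        ∑ _i : Fin N, ENNReal.ofReal (c₁ * (C₀ * M ^ (q + 1))) * I := by
        refine add_le_add ?_ (Finset.sum_le_sum fun i _ => ?_)
        · exact mul_le_mul_of_nonneg_right (ENNReal.ofReal_le_ofReal hKq) zero_le
        · rw [ENNReal.ofReal_mul hc₁0, mul_assoc]
          exact mul_le_mul_of_nonneg_left (hstep2 i) zero_le
    _ = ENNReal.ofReal (c₁ * C₀ * M ^ (q + 1) + ∑ _i : Fin N, c₁ * (C₀ * M ^ (q + 1))) * I := by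
        rw [← Finset.sum_mul, ← add_mul, ← ENNReal.ofReal_sum_of_nonneg
          (fun i _ => mul_nonneg hc₁0 (mul_nonneg hC00 (pow_nonneg hM0 _))),
          ← ENNReal.ofReal_add (mul_nonneg (mul_nonneg hc₁0 hC00) (pow_nonneg hM0 _))
          (Finset.sum_nonneg fun i _ => mul_nonneg hc₁0 (mul_nonneg hC00 (pow_nonneg hM0 _)))]
    _ ≤ ENNReal.ofReal (C₀ * ((N : ℝ) + 1) ^ (2 * (q + 1)) * R ^ (q + 1) * M ^ (q + 1)) * I :=
        mul_le_mul_of_nonneg_right (ENNReal.ofReal_le_ofReal htot) zero_le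

end Summit.KontsevichZagierPeriods.KontsevichZagierPeriods.Theorems

end
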